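import Summits.HodgeConjecture.HodgeConjecture.Theorems.LinearSystemTorelliLocalTubeSpanUnimodularTransitivityLemmas
import Mathlib.RingTheory.Localization.Module
import Mathlib.LinearAlgebra.FreeModule.PID

/-!
# Route LinearSystemTorelli — crux `LocalTubeSpan` (stmt-HodgeConjecture-2490): lattice coordinates of `ℤΔ`

Helper file of line `Sketch`, cycle 8 (continuation lead c7), serving the descent of Janssen's
Theorem 2.5 (`…Descent`).  The lattice `ℤΔ` of a subset `Δ` spanning the `ℚ`-space `V` with `ℤΔ`
finitely generated is free of finite rank, and its `ℤ`-basis is a `ℚ`-basis of `V` whose coordinate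
functionals are integral on `ℤΔ`.  Hence:

* `localTubeSpan_exists_half_of_even` — a vector on which every integral functional is EVEN is twice a
  lattice vector;
* `localTubeSpan_eq_zero_of_integral_functionals` — a vector killed by every integral functional is `0`;
* `localTubeSpan_even_of_sp2` — Schnell's displayed `Sp♯₂` condition `l(gx - x) = 2⟨v, x⟩` makes `g y - y`
  even for `y ∈ ℤΔ` (integral `B`);
* `localTubeSpan_sqMove_zpow_apply` — integer powers of a unit acting as `T_a²`.

No named facts; no `sorry`.
-/

-- `Summit.HodgeConjecture.HodgeConjecture.Theorems` is the mandated namespace (single-conjunct summit: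
-- Sub = Summit), which `linter.dupNamespace` flags on every declaration; the lakefile turns the
-- linter off tree-wide (weak option), restated here so stand-alone elaboration is warning-free too.
set_option linter.dupNamespace false

noncomputable section

open Literature.AlgebraicGeometry.HodgeTheory

namespace Summit.HodgeConjecture.HodgeConjecture.Theorems

variable {V : Type} [AddCommGroup V] [Module ℚ V]

/-- Lattice coordinates: a vector on which every functional integral on `ℤΔ` takes EVEN values is twice
a lattice vector (`ℤΔ` is free of finite rank; its `ℤ`-basis is a `ℚ`-basis of `V` whose coordinate
functionals are integral on `ℤΔ`). [folklore] -/
theorem localTubeSpan_exists_half_of_even (Δ : Set V) (hfg : (Submodule.span ℤ Δ).FG)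
    (hsp : Submodule.span ℚ Δ = ⊤) {x : V}
    (heven : ∀ l : V →ₗ[ℚ] ℚ, (∀ y ∈ Submodule.span ℤ Δ, ∃ z : ℤ, l y = z) →
      ∃ z : ℤ, l x = 2 * z) :
    ∃ z ∈ Submodule.span ℤ Δ, x = (2 : ℚ) • z := by
  classical
  set Λ := Submodule.span ℤ Δ with hΛdef
  have htf : IsAddTorsionFree V := IsAddTorsionFree.of_module_rat V
  haveI : Module.Finite ℤ Λ := Module.Finite.iff_fg.2 hfg
  haveI : Module.Free ℤ Λ := inferInstance
  let bZ := Module.Free.chooseBasis ℤ Λ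
  let f : Module.Free.ChooseBasisIndex ℤ Λ → V := fun i => (bZ i : V)
  have hfmem : ∀ i, f i ∈ Λ := fun i => (bZ i).2
  have hfZ : LinearIndependent ℤ f :=
    bZ.linearIndependent.map' Λ.subtype (Submodule.ker_subtype Λ)
  have hfQ : LinearIndependent ℚ f := (LinearIndependent.iff_fractionRing ℤ ℚ).1 hfZ
  -- every lattice vector is an integral combination of the `f i`
  have hrepZ : ∀ (y : V) (hy : y ∈ Λ), y = ∑ i, ((bZ.repr ⟨y, hy⟩ i : ℤ) : ℚ) • f i := by
    intro y hy
    have h1 := congrArg (fun t : Λ => (t : V)) (bZ.sum_repr ⟨y, hy⟩)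
    simp only [Submodule.coe_sum, Submodule.coe_smul] at h1
    exact h1.symm.trans (Finset.sum_congr rfl fun i _ => (Int.cast_smul_eq_zsmul ℚ _ _).symm)
  -- spanning
  have hspan : Submodule.span ℚ (Set.range f) = ⊤ := by
    refine eq_top_iff.2 ?_
    rw [← hsp, Submodule.span_le]
    intro y hy
    rw [SetLike.mem_coe, hrepZ y (Submodule.subset_span hy)]
    exact Submodule.sum_mem _ fun i _ =>
      Submodule.smul_mem _ _ (Submodule.subset_span ⟨i, rfl⟩)
  let bQ : Module.Basis (Module.Free.ChooseBasisIndex ℤ Λ) ℚ V := Module.Basis.mk hfQ (by rw [hspan])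
  have hbQ : ∀ i, bQ i = f i := fun i => Module.Basis.mk_apply hfQ (by rw [hspan]) i
  -- coordinates of lattice vectors are integers
  have hcoordZ : ∀ (y : V) (hy : y ∈ Λ) (i), bQ.coord i y = ((bZ.repr ⟨y, hy⟩ i : ℤ) : ℚ) := by
    intro y hy i
    have hy' : y = ∑ j, ((bZ.repr ⟨y, hy⟩ j : ℤ) : ℚ) • bQ j :=
      (hrepZ y hy).trans (Finset.sum_congr rfl fun j _ => by rw [hbQ])
    rw [Module.Basis.coord_apply]
    conv_lhs => rw [hy']
    rw [Module.Basis.repr_sum_self]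
  -- the coordinates of `x` are even
  have hxeven : ∀ i, ∃ z : ℤ, bQ.coord i x = 2 * z := fun i =>
    heven (bQ.coord i) fun y hy => ⟨bZ.repr ⟨y, hy⟩ i, hcoordZ y hy i⟩
  choose z hz using hxeven
  refine ⟨∑ i, (z i : ℚ) • f i,
    Submodule.sum_mem _ fun i _ => ?_, ?_⟩
  · rw [Int.cast_smul_eq_zsmul]
    exact Submodule.smul_mem _ _ (hfmem i)
  · conv_lhs => rw [← bQ.sum_repr x]
    rw [Finset.smul_sum]
    refine Finset.sum_congr rfl fun i _ => ?_
    rw [← Module.Basis.coord_apply, hz i, hbQ, smul_smul]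

/-- Lattice coordinates, zero form: a vector killed by every functional integral on `ℤΔ` is zero.
[folklore] -/
theorem localTubeSpan_eq_zero_of_integral_functionals (Δ : Set V) (hfg : (Submodule.span ℤ Δ).FG)
    (hsp : Submodule.span ℚ Δ = ⊤) {x : V}
    (hzero : ∀ l : V →ₗ[ℚ] ℚ, (∀ y ∈ Submodule.span ℤ Δ, ∃ z : ℤ, l y = z) → l x = 0) : x = 0 := by
  classical
  set Λ := Submodule.span ℤ Δ with hΛdef
  have htf : IsAddTorsionFree V := IsAddTorsionFree.of_module_rat V
  haveI : Module.Finite ℤ Λ := Module.Finite.iff_fg.2 hfg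
  haveI : Module.Free ℤ Λ := inferInstance
  let bZ := Module.Free.chooseBasis ℤ Λ
  let f : Module.Free.ChooseBasisIndex ℤ Λ → V := fun i => (bZ i : V)
  have hfZ : LinearIndependent ℤ f :=
    bZ.linearIndependent.map' Λ.subtype (Submodule.ker_subtype Λ)
  have hfQ : LinearIndependent ℚ f := (LinearIndependent.iff_fractionRing ℤ ℚ).1 hfZ
  have hrepZ : ∀ (y : V) (hy : y ∈ Λ), y = ∑ i, ((bZ.repr ⟨y, hy⟩ i : ℤ) : ℚ) • f i := by
    intro y hy
    have h1 := congrArg (fun t : Λ => (t : V)) (bZ.sum_repr ⟨y, hy⟩)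
    simp only [Submodule.coe_sum, Submodule.coe_smul] at h1
    exact h1.symm.trans (Finset.sum_congr rfl fun i _ => (Int.cast_smul_eq_zsmul ℚ _ _).symm)
  have hspan : Submodule.span ℚ (Set.range f) = ⊤ := by
    refine eq_top_iff.2 ?_
    rw [← hsp, Submodule.span_le]
    intro y hy
    rw [SetLike.mem_coe, hrepZ y (Submodule.subset_span hy)]
    exact Submodule.sum_mem _ fun i _ =>
      Submodule.smul_mem _ _ (Submodule.subset_span ⟨i, rfl⟩)
  let bQ : Module.Basis (Module.Free.ChooseBasisIndex ℤ Λ) ℚ V := Module.Basis.mk hfQ (by rw [hspan])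
  have hbQ : ∀ i, bQ i = f i := fun i => Module.Basis.mk_apply hfQ (by rw [hspan]) i
  have hcoordZ : ∀ (y : V) (hy : y ∈ Λ) (i), bQ.coord i y = ((bZ.repr ⟨y, hy⟩ i : ℤ) : ℚ) := by
    intro y hy i
    have hy' : y = ∑ j, ((bZ.repr ⟨y, hy⟩ j : ℤ) : ℚ) • bQ j :=
      (hrepZ y hy).trans (Finset.sum_congr rfl fun j _ => by rw [hbQ])
    rw [Module.Basis.coord_apply]
    conv_lhs => rw [hy']
    rw [Module.Basis.repr_sum_self]
  have hx0 : ∀ i, bQ.coord i x = 0 := fun i =>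
    hzero (bQ.coord i) fun y hy => ⟨bZ.repr ⟨y, hy⟩ i, hcoordZ y hy i⟩
  rw [← bQ.sum_repr x]
  refine Finset.sum_eq_zero fun i _ => ?_
  rw [← Module.Basis.coord_apply, hx0 i, zero_smul]

/-- The fourth `Sp♯₂` condition makes `g y - y` even in lattice coordinates (`y ∈ ℤΔ`, `B` integral
on `Δ`): every integral functional takes an even value on it. [folklore] -/
theorem localTubeSpan_even_of_sp2 (B : LinearMap.BilinForm ℚ V) (Δ : Set V)
    (hint : ∀ δ ∈ Δ, ∀ δ' ∈ Δ, ∃ n : ℤ, B δ δ' = n) (g : (V →ₗ[ℚ] V)ˣ)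
    (h4 : ∀ l : V →ₗ[ℚ] ℚ, (∀ x ∈ Submodule.span ℤ Δ, ∃ z : ℤ, l x = z) →
      ∃ v ∈ Submodule.span ℤ Δ, ∀ x ∈ Submodule.span ℤ Δ, l ((g : V →ₗ[ℚ] V) x - x) = 2 * B v x)
    {y : V} (hy : y ∈ Submodule.span ℤ Δ) (l : V →ₗ[ℚ] ℚ)
    (hl : ∀ x ∈ Submodule.span ℤ Δ, ∃ z : ℤ, l x = z) :
    ∃ z : ℤ, l ((g : V →ₗ[ℚ] V) y - y) = 2 * z := by
  obtain ⟨v, hv, hvx⟩ := h4 l hl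
  obtain ⟨n, hn⟩ := localTubeSpan_integral_span B Δ hint hv hy
  exact ⟨n, by rw [hvx y hy, hn]⟩

/-- Integer powers of a unit acting as a squared transvection `T_a²` (`v ↦ v - 2⟨v,a⟩a`):
`g^k v = v - 2k ⟨v,a⟩ a`. [folklore] -/
theorem localTubeSpan_sqMove_zpow_apply (B : LinearMap.BilinForm ℚ V) (hB : B.IsAlt) (a : V)
    (g : (V →ₗ[ℚ] V)ˣ) (hg : ∀ v, (g : V →ₗ[ℚ] V) v = v - (2 : ℚ) • (B v a • a)) (k : ℤ) (v : V) :
    ((g ^ k : (V →ₗ[ℚ] V)ˣ) : V →ₗ[ℚ] V) v = v - (2 * (k : ℚ)) • (B v a • a) := by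
  obtain ⟨n, rfl | rfl⟩ := Int.eq_nat_or_neg k
  · rw [zpow_natCast, localTubeSpan_sqMove_pow_apply B hB a g hg n v, Int.cast_natCast]
  · rw [zpow_neg, zpow_natCast, ← inv_pow, localTubeSpan_sqMove_inv_pow_apply B hB a g hg n v,
      Int.cast_neg, Int.cast_natCast]
    module

end Summit.HodgeConjecture.HodgeConjecture.Theorems

end
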